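import Literature.NumberTheory.EllipticCurves.RootNumberLocalConstancy
import Literature.NumberTheory.EllipticCurves.RootNumberLocalSmulProofs
import Literature.NumberTheory.EllipticCurves.BSDRootNumberLocalTablesProofs
import Literature.NumberTheory.DiophantineGeometry.TateAlgorithmProofs
import HarnessLib

/-!
# Local constancy of local root numbers — proofs (Helfgott 2004, §4, residue characteristic `≥ 5`)

A `…Proofs` sibling (theorems only: no definition, no named fact, no instance) of
`Literature.NumberTheory.EllipticCurves.RootNumberLocalConstancy`, written by the `provefact` seat
of the named fact `Literature.NumberTheory.EllipticCurves.Helfgott2004_exists_local_tables_locallyConstant`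
(Helfgott 2004, Prop. 4.2, proof of Prop. 4.3 and Lemma 4.4: the local root number `W(E/K)` of an
elliptic curve over a local field `K` is a locally constant function of the integral coefficients
`(a₁, …, a₆)`; vendored over `K = ℚ_v` as clause (5) of a strengthening of
`exists_local_tables_two_three`).

## What is proved, and what the discharge still needs

The named fact implies `exists_local_tables_two_three` (**bsd.S36**: the analytic global root
number is `−∏_v w_v`, local tables at *all* places including `2, 3`), whose every known proof
passes through the Modularity Theorem (`exists_isNewformOf`, an undischarged named fact) and the
locality of the Atkin–Lehner signs above `2, 3` (see the docstring of `exists_local_tables_two_three`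
and `BSDRootNumberLocalTablesProofs`); so `Helfgott2004_exists_local_tables_locallyConstant_holds`
cannot be proved in the present tree. This file proves the part of clause (5) that does not depend
on the unknown tables at `2` and `3`, following Helfgott's own argument (proof of Prop. 4.3, PDF
p. 11 of `paper:arxiv-math_0408141`: "there is one change of variables that sends any nearby
`𝐚₁, …, 𝐚₆ ∈ 𝒪_K` with `𝚫 ≠ 0` to a minimal Weierstrass model … Thus, the reduction type is
constant in the neighbourhood … When an elliptic curve has multiplicative reduction, the root number
depends only on whether the reduction is split or unsplit; when an elliptic curve has additive,
potentially multiplicative reduction, the root number depends only on `K` and the class of `−c₆` …")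
combined, in residue characteristic `p ≥ 5`, with Rohrlich's case list (Rohrlich 1993, Prop. 2:
at potentially good places `W` is a function of `e = 12 / gcd(v(Δ_min), 12)` and of `p`), which is
what the tree's `WeierstrassCurve.localRootNumber` transcribes — so that in residue characteristic
`≥ 5` the Tate-module argument of Helfgott's Prop. 4.2 is replaced by the local constancy of
`v(Δ_min)`:

* `WeierstrassCurve.localRootNumber_locallyConstant_of_isUnit` — over any DVR `R` with `2, 3 ∈ Rˣ`
  and fraction field `K`: for an `R`-integral `W₁` with `Δ ≠ 0` there is `z ∈ Kˣ` such that every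
  `W₂` with `v (aⱼ(W₂) − aⱼ(W₁)) < v (z)` has `localRootNumber R W₂ = localRootNumber R W₁`.
  Ingredients, all proved here or in the tree: the minimising change of variables `D = ⟨u, r, s, t⟩`
  of `W₁` has `u, r, s, t ∈ R` (Silverman AEC VII.1.3(d): `valuation_u_le_one_of_isMinimal_smul` and
  the tree's `exists_lift_variableChange_of_isIntegral`); the coefficients of `D • W` are
  `v`-adically Lipschitz in those of `W` with constant `|u|⁻⁶` (`valuation_variableChange_sub_lt`,
  Helfgott's "`|𝐚ⱼ − aⱼ| < |u|⁷`"); congruent integral equations have congruent `Δ`, `c₄` and equal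
  reductions (`valuation_Δ_sub_le_and_c₄_sub_le`, `map_integralModel_eq_of_valuation_sub_lt_one`);
  the minimality criterion of AEC VII.1, Remark 1.1 in residue characteristic `≠ 2, 3`, "the
  equation is minimal iff `v(Δ) < 12` or `v(c₄) < 4`" (`not_Δ_mem_pow_and_c₄_mem_pow_of_isMinimal`,
  via the short Weierstrass form and the tree's Step 11 `not_isMinimal_of_pow_dvd`;
  `isMinimal_of_not_Δ_mem_pow_and_c₄_mem_pow`); and AEC VII.1.3(b) for the passage to Mathlib's
  chosen minimal model (the tree's `…_iff_of_isMinimal_of_eq_smul` lemmas).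
* `localRootNumber_adicCompletion_locallyConstant` — the same over `ℚ_v`, `v ∤ 6`, in the exact
  shape of clause (5) (`Valued.v (𝐚ⱼ − aⱼ) < exp (−n)`).
* `locallyConstant_of_eq_localRootNumber` — hence clause (5) holds at every `v ∤ 6` for any table
  satisfying clause (3); `exists_local_tables_locallyConstant_of_two_three` — the tables of
  `exists_local_tables_two_three` are automatically locally constant away from `2, 3`.
* `Helfgott2004_exists_local_tables_locallyConstant_iff_two_three` — the named fact is equivalent
  to the existence of tables with clauses (1)–(4) that are locally constant **at the places above
  `2` and `3`**. The residual content beyond `exists_local_tables_two_three` is thus Helfgott's §4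
  at `v ∣ 6` for the true local root numbers `W(E/ℚ₂)`, `W(E/ℚ₃)` (`ε`-factors of the
  Weil–Deligne representation; Halberstadt's tables), for which the tree has no definition.

## References

* H. A. Helfgott, *On the behaviour of root numbers in families of elliptic curves*,
  arXiv:math/0408141 (2004), §4: Prop. 4.2, Prop. 4.3 and its proof (PDF p. 11), Lemma 4.4.
  [Helfgott2004RootNumberFamilies]
* D. Rohrlich, *Variation of the root number in families of elliptic curves*, Compositio Math. 87
  (1993), Prop. 2. [Rohrlich1993Compositio]
* J. H. Silverman, *The Arithmetic of Elliptic Curves*, GTM 106, 2nd ed. 2009, VII.1: Definition,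
  Remark 1.1 and Prop. 1.3(b),(d) (PDF pp. 165–166). [SilvermanAEC2009]
* J. H. Silverman, *Advanced Topics in the Arithmetic of Elliptic Curves*, GTM 151, 1994, IV.9.4
  Step 11. [SilvermanATAEC1994]
-/

noncomputable section

open scoped Classical

open IsDedekindDomain IsDiscreteValuationRing IsDedekindDomain.HeightOneSpectrum

namespace WeierstrassCurve

section DVR

variable (R : Type*) [CommRing R] [IsDomain R] [IsDiscreteValuationRing R]
  {K : Type*} [Field K] [Algebra R K] [IsFractionRing R K]

/-- `v (a) ≤ exp (-n) ↔ a ∈ 𝔪ⁿ` for `a ∈ R`. [folklore] -/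
theorem valuation_maximalIdeal_algebraMap_le_exp_neg_iff (a : R) (n : ℕ) :
    valuation K (maximalIdeal R) (algebraMap R K a) ≤ WithZero.exp (-(n : ℤ)) ↔
      a ∈ IsLocalRing.maximalIdeal R ^ n := by
  rw [valuation_of_algebraMap, intValuation_le_pow_iff_mem]; rfl

/-- `v (a) < 1 ↔ a ∈ 𝔪` for `a ∈ R`. [folklore] -/
theorem valuation_maximalIdeal_algebraMap_lt_one_iff (a : R) :
    valuation K (maximalIdeal R) (algebraMap R K a) < 1 ↔ a ∈ IsLocalRing.maximalIdeal R := by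
  rw [valuation_lt_one_iff_mem]; rfl

/-- **Silverman, AEC VII.1, Prop. 1.3(d), the `u ∈ R` part.** If `W` is an `R`-integral Weierstrass
equation with `Δ ≠ 0` and `D • W` is minimal, then the scaling `u` of `D` is integral: minimality
gives `v (Δ (W)) ≤ v (Δ (D • W)) = v (u)⁻¹² v (Δ (W))`.
[cite: SilvermanAEC2009, VII.1 Prop. 1.3(d) (PDF p. 166)] -/
theorem valuation_u_le_one_of_isMinimal_smul (W : WeierstrassCurve K) [IsIntegral R W]
    (D : VariableChange K) [IsMinimal R (D • W)] (hΔ : W.Δ ≠ 0) :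
    valuation K (maximalIdeal R) (D.u : K) ≤ 1 := by
  haveI hint : IsIntegral R (D⁻¹ • D • W) := by rw [inv_smul_smul]; infer_instance
  have h := valuation_Δ_aux_smul_le_of_isMinimal R (D • W) D⁻¹
  rw [← Subtype.coe_le_coe, valuation_Δ_aux_eq_of_isIntegral,
    valuation_Δ_aux_eq_of_isIntegral, inv_smul_smul] at h
  have e : W.Δ = (D.u : K) ^ 12 * (D • W).Δ := by
    rw [variableChange_Δ, ← mul_assoc, ← mul_pow, Units.mul_inv, one_pow, one_mul]
  rw [e, map_mul, map_pow] at h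
  have h0 : valuation K (maximalIdeal R) (D • W).Δ ≠ 0 := by
    rw [ne_eq, map_eq_zero, variableChange_Δ]
    exact mul_ne_zero (pow_ne_zero _ (Units.ne_zero _)) hΔ
  have hX : 0 < valuation K (maximalIdeal R) (D • W).Δ := zero_lt_iff.2 h0
  have h1 : valuation K (maximalIdeal R) (D.u : K) ^ 12 ≤ 1 := by
    rw [mul_comm] at h
    rw [← mul_le_mul_iff_right₀ hX, mul_one]; exact h
  by_contra hu
  rw [not_le] at hu
  exact absurd h1 (not_le.mpr (one_lt_pow₀ hu (by norm_num)))

/-- **The coefficients of `D • W` are `v`-adically continuous in those of `W`**, uniformly for a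
change of variables `D = ⟨u, r, s, t⟩` with `v (u), v (r), v (s), v (t) ≤ 1`: if
`v (aⱼ(W₂) − aⱼ(W₁)) < v (u)⁶ δ` for `j = 1, 2, 3, 4, 6` then `v (aⱼ(D • W₂) − aⱼ(D • W₁)) < δ`.
The transformation formulae (Silverman, AEC III.1, Table 3.1) are affine-linear in `(a₁, …, a₆)`
with coefficients in `ℤ[r, s, t]` and denominators `uʲ`, `j ≤ 6`. (Step "(iii)" of the proof of
Helfgott 2004, Prop. 4.2: for `|𝐚ⱼ − aⱼ| < |u|⁷` the same change of variables still produces an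
integral model.) [cite: Helfgott2004RootNumberFamilies, §4 proof of Prop. 4.2] -/
theorem valuation_variableChange_sub_lt {Γ₀ : Type*} [LinearOrderedCommGroupWithZero Γ₀]
    (v : Valuation K Γ₀) {D : VariableChange K} (hu : v (D.u : K) ≤ 1) (hr : v D.r ≤ 1)
    (hs : v D.s ≤ 1) (ht : v D.t ≤ 1) {W₁ W₂ : WeierstrassCurve K} {δ : Γ₀}
    (h₁ : v (W₂.a₁ - W₁.a₁) < v (D.u : K) ^ 6 * δ) (h₂ : v (W₂.a₂ - W₁.a₂) < v (D.u : K) ^ 6 * δ)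
    (h₃ : v (W₂.a₃ - W₁.a₃) < v (D.u : K) ^ 6 * δ) (h₄ : v (W₂.a₄ - W₁.a₄) < v (D.u : K) ^ 6 * δ)
    (h₆ : v (W₂.a₆ - W₁.a₆) < v (D.u : K) ^ 6 * δ) :
    v ((D • W₂).a₁ - (D • W₁).a₁) < δ ∧ v ((D • W₂).a₂ - (D • W₁).a₂) < δ ∧
      v ((D • W₂).a₃ - (D • W₁).a₃) < δ ∧ v ((D • W₂).a₄ - (D • W₁).a₄) < δ ∧
      v ((D • W₂).a₆ - (D • W₁).a₆) < δ := by
  have hu0 : v (D.u : K) ≠ 0 := (v.ne_zero_iff).2 D.u.ne_zero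
  set γ := v (D.u : K) ^ 6 * δ with hγ
  have h2K : v (2 : K) ≤ 1 := by
    have := v.map_add (1 : K) 1
    rwa [v.map_one, max_self, one_add_one_eq_two] at this
  -- products of integral elements with small elements are small
  have hmul : ∀ {c d : K}, v c ≤ 1 → v d < γ → v (c * d) < γ := fun {c d} hc hd ↦ by
    rw [map_mul]
    calc v c * v d ≤ 1 * v d := mul_le_mul_left hc _
      _ = v d := one_mul _
      _ < γ := hd
  -- the numerators of the differences
  have B₂ : v ((W₂.a₂ - W₁.a₂) - D.s * (W₂.a₁ - W₁.a₁)) < γ := v.map_sub_lt h₂ (hmul hs h₁)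
  have B₃ : v ((W₂.a₃ - W₁.a₃) + D.r * (W₂.a₁ - W₁.a₁)) < γ := v.map_add_lt h₃ (hmul hr h₁)
  have B₄ : v ((W₂.a₄ - W₁.a₄) - D.s * (W₂.a₃ - W₁.a₃) + 2 * (D.r * (W₂.a₂ - W₁.a₂))
      - (D.t + D.r * D.s) * (W₂.a₁ - W₁.a₁)) < γ := by
    refine v.map_sub_lt (v.map_add_lt (v.map_sub_lt h₄ (hmul hs h₃)) (hmul h2K (hmul hr h₂)))
      (hmul ?_ h₁)
    exact v.map_add_le ht (by rw [map_mul]; exact mul_le_one' hr hs)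
  have B₆ : v ((W₂.a₆ - W₁.a₆) + D.r * (W₂.a₄ - W₁.a₄) + D.r ^ 2 * (W₂.a₂ - W₁.a₂)
      - D.t * (W₂.a₃ - W₁.a₃) - D.r * D.t * (W₂.a₁ - W₁.a₁)) < γ := by
    refine v.map_sub_lt (v.map_sub_lt (v.map_add_lt (v.map_add_lt h₆ (hmul hr h₄)) (hmul ?_ h₂))
      (hmul ht h₃)) (hmul ?_ h₁)
    · rw [map_pow]; exact pow_le_one' hr 2
    · rw [map_mul]; exact mul_le_one' hr ht
  -- scaling by `u⁻ʲ`, `j ≤ 6`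
  have key : ∀ (k : ℕ), k ≤ 6 → ∀ {B : K}, v B < γ → v ((↑D.u⁻¹ : K) ^ k * B) < δ := by
    intro k hk B hB
    rw [map_mul, map_pow, map_units_inv]
    have e : (v (D.u : K))⁻¹ ^ k * γ = v (D.u : K) ^ (6 - k) * δ := by
      rw [hγ, ← mul_assoc, show (6 : ℕ) = k + (6 - k) by omega, pow_add, ← mul_assoc, inv_pow,
        inv_mul_cancel₀ (pow_ne_zero k hu0), one_mul, Nat.add_sub_cancel_left]
    calc (v (D.u : K))⁻¹ ^ k * v B < (v (D.u : K))⁻¹ ^ k * γ :=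
          mul_lt_mul_of_pos_left hB (pow_pos (zero_lt_iff.2 (inv_ne_zero hu0)) _)
      _ = v (D.u : K) ^ (6 - k) * δ := e
      _ ≤ 1 * δ := mul_le_mul_left (pow_le_one' hu _) _
      _ = δ := one_mul δ
  refine ⟨?_, ?_, ?_, ?_, ?_⟩
  · have e : (D • W₂).a₁ - (D • W₁).a₁ = (↑D.u⁻¹ : K) ^ 1 * (W₂.a₁ - W₁.a₁) := by
      rw [variableChange_a₁, variableChange_a₁]; ring
    rw [e]; exact key 1 (by norm_num) h₁
  · have e : (D • W₂).a₂ - (D • W₁).a₂ =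
        (↑D.u⁻¹ : K) ^ 2 * ((W₂.a₂ - W₁.a₂) - D.s * (W₂.a₁ - W₁.a₁)) := by
      rw [variableChange_a₂, variableChange_a₂]; ring
    rw [e]; exact key 2 (by norm_num) B₂
  · have e : (D • W₂).a₃ - (D • W₁).a₃ =
        (↑D.u⁻¹ : K) ^ 3 * ((W₂.a₃ - W₁.a₃) + D.r * (W₂.a₁ - W₁.a₁)) := by
      rw [variableChange_a₃, variableChange_a₃]; ring
    rw [e]; exact key 3 (by norm_num) B₃
  · have e : (D • W₂).a₄ - (D • W₁).a₄ =
        (↑D.u⁻¹ : K) ^ 4 * ((W₂.a₄ - W₁.a₄) - D.s * (W₂.a₃ - W₁.a₃) + 2 * (D.r * (W₂.a₂ - W₁.a₂))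
          - (D.t + D.r * D.s) * (W₂.a₁ - W₁.a₁)) := by
      rw [variableChange_a₄, variableChange_a₄]; ring
    rw [e]; exact key 4 (by norm_num) B₄
  · have e : (D • W₂).a₆ - (D • W₁).a₆ =
        (↑D.u⁻¹ : K) ^ 6 * ((W₂.a₆ - W₁.a₆) + D.r * (W₂.a₄ - W₁.a₄) + D.r ^ 2 * (W₂.a₂ - W₁.a₂)
          - D.t * (W₂.a₃ - W₁.a₃) - D.r * D.t * (W₂.a₁ - W₁.a₁)) := by
      rw [variableChange_a₆, variableChange_a₆]; ring
    rw [e]; exact key 6 le_rfl B₆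


/-! ### Congruent integral equations -/

/-- An equation whose coefficients are within distance `≤ 1` of those of an `R`-integral equation
is `R`-integral. [folklore] -/
theorem isIntegral_of_valuation_sub_le_one {X₁ X₂ : WeierstrassCurve K} [hX₁ : IsIntegral R X₁]
    (h₁ : valuation K (maximalIdeal R) (X₂.a₁ - X₁.a₁) ≤ 1)
    (h₂ : valuation K (maximalIdeal R) (X₂.a₂ - X₁.a₂) ≤ 1)
    (h₃ : valuation K (maximalIdeal R) (X₂.a₃ - X₁.a₃) ≤ 1)
    (h₄ : valuation K (maximalIdeal R) (X₂.a₄ - X₁.a₄) ≤ 1)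
    (h₆ : valuation K (maximalIdeal R) (X₂.a₆ - X₁.a₆) ≤ 1) : IsIntegral R X₂ := by
  have hν := valuation_maximalIdeal_le_one_iff R (K := K)
  obtain ⟨i₁, i₂, i₃, i₄, i₆⟩ := (isIntegral_iff_forall_mem_range X₁).1 hX₁
  rw [← hν] at i₁ i₂ i₃ i₄ i₆
  rw [isIntegral_iff_forall_mem_range, ← hν, ← hν, ← hν, ← hν, ← hν]
  refine ⟨?_, ?_, ?_, ?_, ?_⟩
  · rw [show X₂.a₁ = (X₂.a₁ - X₁.a₁) + X₁.a₁ by ring]; exact Valuation.map_add_le _ h₁ i₁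
  · rw [show X₂.a₂ = (X₂.a₂ - X₁.a₂) + X₁.a₂ by ring]; exact Valuation.map_add_le _ h₂ i₂
  · rw [show X₂.a₃ = (X₂.a₃ - X₁.a₃) + X₁.a₃ by ring]; exact Valuation.map_add_le _ h₃ i₃
  · rw [show X₂.a₄ = (X₂.a₄ - X₁.a₄) + X₁.a₄ by ring]; exact Valuation.map_add_le _ h₄ i₄
  · rw [show X₂.a₆ = (X₂.a₆ - X₁.a₆) + X₁.a₆ by ring]; exact Valuation.map_add_le _ h₆ i₆

/-- Two Weierstrass equations over a commutative ring whose coefficients are congruent modulo an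
ideal `J` have the same reduction modulo `J`. [folklore] -/
theorem map_mk_eq_of_sub_mem {S : Type*} [CommRing S] (J : Ideal S) {I₁ I₂ : WeierstrassCurve S}
    (h₁ : I₂.a₁ - I₁.a₁ ∈ J) (h₂ : I₂.a₂ - I₁.a₂ ∈ J) (h₃ : I₂.a₃ - I₁.a₃ ∈ J)
    (h₄ : I₂.a₄ - I₁.a₄ ∈ J) (h₆ : I₂.a₆ - I₁.a₆ ∈ J) :
    I₂.map (Ideal.Quotient.mk J) = I₁.map (Ideal.Quotient.mk J) := by
  ext
  · simpa only [map_a₁, Ideal.Quotient.mk_eq_mk_iff_sub_mem] using h₁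
  · simpa only [map_a₂, Ideal.Quotient.mk_eq_mk_iff_sub_mem] using h₂
  · simpa only [map_a₃, Ideal.Quotient.mk_eq_mk_iff_sub_mem] using h₃
  · simpa only [map_a₄, Ideal.Quotient.mk_eq_mk_iff_sub_mem] using h₄
  · simpa only [map_a₆, Ideal.Quotient.mk_eq_mk_iff_sub_mem] using h₆

/-- Congruent equations have congruent discriminants and congruent `c₄`. [folklore] -/
theorem Δ_sub_mem_and_c₄_sub_mem_of_sub_mem {S : Type*} [CommRing S] (J : Ideal S)
    {I₁ I₂ : WeierstrassCurve S}
    (h₁ : I₂.a₁ - I₁.a₁ ∈ J) (h₂ : I₂.a₂ - I₁.a₂ ∈ J) (h₃ : I₂.a₃ - I₁.a₃ ∈ J)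
    (h₄ : I₂.a₄ - I₁.a₄ ∈ J) (h₆ : I₂.a₆ - I₁.a₆ ∈ J) :
    I₂.Δ - I₁.Δ ∈ J ∧ I₂.c₄ - I₁.c₄ ∈ J := by
  have h := map_mk_eq_of_sub_mem J h₁ h₂ h₃ h₄ h₆
  constructor
  · rw [← Ideal.Quotient.mk_eq_mk_iff_sub_mem, ← map_Δ, ← map_Δ, h]
  · rw [← Ideal.Quotient.mk_eq_mk_iff_sub_mem, ← map_c₄, ← map_c₄, h]

/-- The integral models of two `R`-integral equations whose coefficients differ by elements of
valuation `≤ exp (-n)` are congruent modulo `𝔪ⁿ`. [folklore] -/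
theorem integralModel_sub_mem_pow {X₁ X₂ : WeierstrassCurve K} [IsIntegral R X₁]
    [IsIntegral R X₂] {n : ℕ}
    (h₁ : valuation K (maximalIdeal R) (X₂.a₁ - X₁.a₁) ≤ WithZero.exp (-(n : ℤ)))
    (h₂ : valuation K (maximalIdeal R) (X₂.a₂ - X₁.a₂) ≤ WithZero.exp (-(n : ℤ)))
    (h₃ : valuation K (maximalIdeal R) (X₂.a₃ - X₁.a₃) ≤ WithZero.exp (-(n : ℤ)))
    (h₄ : valuation K (maximalIdeal R) (X₂.a₄ - X₁.a₄) ≤ WithZero.exp (-(n : ℤ)))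
    (h₆ : valuation K (maximalIdeal R) (X₂.a₆ - X₁.a₆) ≤ WithZero.exp (-(n : ℤ))) :
    (X₂.integralModel R).a₁ - (X₁.integralModel R).a₁ ∈ IsLocalRing.maximalIdeal R ^ n ∧
    (X₂.integralModel R).a₂ - (X₁.integralModel R).a₂ ∈ IsLocalRing.maximalIdeal R ^ n ∧
    (X₂.integralModel R).a₃ - (X₁.integralModel R).a₃ ∈ IsLocalRing.maximalIdeal R ^ n ∧
    (X₂.integralModel R).a₄ - (X₁.integralModel R).a₄ ∈ IsLocalRing.maximalIdeal R ^ n ∧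
    (X₂.integralModel R).a₆ - (X₁.integralModel R).a₆ ∈ IsLocalRing.maximalIdeal R ^ n := by
  refine ⟨?_, ?_, ?_, ?_, ?_⟩ <;>
    rw [← valuation_maximalIdeal_algebraMap_le_exp_neg_iff R (K := K), map_sub]
  · rwa [integralModel_a₁_eq, integralModel_a₁_eq]
  · rwa [integralModel_a₂_eq, integralModel_a₂_eq]
  · rwa [integralModel_a₃_eq, integralModel_a₃_eq]
  · rwa [integralModel_a₄_eq, integralModel_a₄_eq]
  · rwa [integralModel_a₆_eq, integralModel_a₆_eq]

/-- `Δ` and `c₄` of two `R`-integral equations whose coefficients differ by elements of valuation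
`≤ exp (-n)` differ by elements of valuation `≤ exp (-n)`. [folklore] -/
theorem valuation_Δ_sub_le_and_c₄_sub_le {X₁ X₂ : WeierstrassCurve K} [IsIntegral R X₁]
    [IsIntegral R X₂] {n : ℕ}
    (h₁ : valuation K (maximalIdeal R) (X₂.a₁ - X₁.a₁) ≤ WithZero.exp (-(n : ℤ)))
    (h₂ : valuation K (maximalIdeal R) (X₂.a₂ - X₁.a₂) ≤ WithZero.exp (-(n : ℤ)))
    (h₃ : valuation K (maximalIdeal R) (X₂.a₃ - X₁.a₃) ≤ WithZero.exp (-(n : ℤ)))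
    (h₄ : valuation K (maximalIdeal R) (X₂.a₄ - X₁.a₄) ≤ WithZero.exp (-(n : ℤ)))
    (h₆ : valuation K (maximalIdeal R) (X₂.a₆ - X₁.a₆) ≤ WithZero.exp (-(n : ℤ))) :
    valuation K (maximalIdeal R) (X₂.Δ - X₁.Δ) ≤ WithZero.exp (-(n : ℤ)) ∧
      valuation K (maximalIdeal R) (X₂.c₄ - X₁.c₄) ≤ WithZero.exp (-(n : ℤ)) := by
  obtain ⟨m₁, m₂, m₃, m₄, m₆⟩ := integralModel_sub_mem_pow R h₁ h₂ h₃ h₄ h₆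
  obtain ⟨hΔ, hc₄⟩ := Δ_sub_mem_and_c₄_sub_mem_of_sub_mem _ m₁ m₂ m₃ m₄ m₆
  constructor
  · rw [← integralModel_Δ_eq R X₂, ← integralModel_Δ_eq R X₁, ← map_sub,
      valuation_maximalIdeal_algebraMap_le_exp_neg_iff]
    exact hΔ
  · rw [← integralModel_c₄_eq R X₂, ← integralModel_c₄_eq R X₁, ← map_sub,
      valuation_maximalIdeal_algebraMap_le_exp_neg_iff]
    exact hc₄

/-- Two `R`-integral equations whose coefficients differ by elements of valuation `< 1` have the
same reduction modulo `𝔪`. [folklore] -/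
theorem map_integralModel_eq_of_valuation_sub_lt_one {X₁ X₂ : WeierstrassCurve K}
    [IsIntegral R X₁] [IsIntegral R X₂]
    (h₁ : valuation K (maximalIdeal R) (X₂.a₁ - X₁.a₁) < 1)
    (h₂ : valuation K (maximalIdeal R) (X₂.a₂ - X₁.a₂) < 1)
    (h₃ : valuation K (maximalIdeal R) (X₂.a₃ - X₁.a₃) < 1)
    (h₄ : valuation K (maximalIdeal R) (X₂.a₄ - X₁.a₄) < 1)
    (h₆ : valuation K (maximalIdeal R) (X₂.a₆ - X₁.a₆) < 1) :
    (X₂.integralModel R).map (algebraMap R (IsLocalRing.ResidueField R)) =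
      (X₁.integralModel R).map (algebraMap R (IsLocalRing.ResidueField R)) := by
  rw [show algebraMap R (IsLocalRing.ResidueField R) =
    Ideal.Quotient.mk (IsLocalRing.maximalIdeal R) from rfl]
  apply map_mk_eq_of_sub_mem <;>
    rw [← valuation_maximalIdeal_algebraMap_lt_one_iff R (K := K), map_sub]
  · rwa [integralModel_a₁_eq, integralModel_a₁_eq]
  · rwa [integralModel_a₂_eq, integralModel_a₂_eq]
  · rwa [integralModel_a₃_eq, integralModel_a₃_eq]
  · rwa [integralModel_a₄_eq, integralModel_a₄_eq]
  · rwa [integralModel_a₆_eq, integralModel_a₆_eq]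

/-! ### The minimality criterion in residue characteristic `≠ 2, 3` -/

open Literature.NumberTheory.DiophantineGeometry.TateAlgorithm in
/-- **Minimality criterion, residue characteristic `≠ 2, 3`** (Silverman, AEC VII.1, Remark 1.1:
"if char `k ≠ 2, 3`, the equation is minimal if and only if `v(Δ) < 12` or `v(c₄) < 4`"), the
`only if` half: a minimal equation of an elliptic curve (`Δ ≠ 0`) over `K = Frac R`, `2, 3 ∈ Rˣ`,
cannot have `Δ ∈ 𝔪¹²` and `c₄ ∈ 𝔪⁴` (integral model). Proof: then `c₆² = c₄³ − 1728 Δ ∈ 𝔪¹²`,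
so `c₆ ∈ 𝔪⁶`; the `R`-integral change of variables to short Weierstrass form (`2, 3` units,
Mathlib's `toShortNF`, `u = 1`) gives `a₁ = a₂ = a₃ = 0`, `a₄ = −c₄/48 ∈ 𝔪⁴`, `a₆ = −c₆/864 ∈ 𝔪⁶`,
and `(x, y) ↦ (π² x, π³ y)` contradicts minimality (Silverman ATAEC IV.9.4, Step 11, the tree's
`not_isMinimal_of_pow_dvd`). [cite: SilvermanAEC2009, VII.1 Remark 1.1 (PDF p. 165)] -/
theorem not_Δ_mem_pow_and_c₄_mem_pow_of_isMinimal (h2 : IsUnit (2 : R)) (h3 : IsUnit (3 : R))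
    (X : WeierstrassCurve K) [IsMinimal R X] (hΔ : X.Δ ≠ 0) :
    ¬ ((X.integralModel R).Δ ∈ IsLocalRing.maximalIdeal R ^ 12 ∧
        (X.integralModel R).c₄ ∈ IsLocalRing.maximalIdeal R ^ 4) := by
  rintro ⟨hΔ12, hc₄4⟩
  letI : Invertible (2 : R) := h2.invertible
  letI : Invertible (3 : R) := h3.invertible
  have hIΔ : (X.integralModel R).Δ ≠ 0 := by
    intro h0
    apply hΔ
    rw [← integralModel_Δ_eq R X, h0, map_zero]
  -- `c₆ ∈ 𝔪⁶`
  have hc₆sq : (X.integralModel R).c₆ ^ 2 ∈ IsLocalRing.maximalIdeal R ^ 12 := by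
    have e : (X.integralModel R).c₆ ^ 2 =
        (X.integralModel R).c₄ ^ 3 - 1728 * (X.integralModel R).Δ := by
      rw [(X.integralModel R).c_relation]; ring
    rw [e]
    refine Ideal.sub_mem _ ?_ (Ideal.mul_mem_left _ _ hΔ12)
    have := Ideal.pow_mem_pow hc₄4 3
    rwa [← pow_mul] at this
  have hc₆ : uniformizer R ^ 6 ∣ (X.integralModel R).c₆ := by
    have h12 : uniformizer R ^ 12 ∣ (X.integralModel R).c₆ ^ 2 :=
      mem_maximalIdeal_pow_iff_dvd.mp hc₆sq
    rw [pow_dvd_iff_le_addVal] at h12 ⊢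
    rw [addVal_pow, nsmul_eq_mul] at h12
    generalize addVal R (X.integralModel R).c₆ = w at h12 ⊢
    induction w using ENat.recTopCoe with
    | top => exact le_top
    | coe m =>
      norm_cast at h12
      exact_mod_cast (show 6 ≤ m by omega)
  -- the short Weierstrass form over `R`
  set D := (X.integralModel R).toShortNF with hD
  have hu : D.u = 1 := by
    simp [hD, WeierstrassCurve.toShortNF, WeierstrassCurve.VariableChange.mul_def]
  have hSc₄ : (D • X.integralModel R).c₄ = (X.integralModel R).c₄ := by
    rw [variableChange_c₄, hu, inv_one, Units.val_one, one_pow, one_mul]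
  have hSc₆ : (D • X.integralModel R).c₆ = (X.integralModel R).c₆ := by
    rw [variableChange_c₆, hu, inv_one, Units.val_one, one_pow, one_mul]
  have h48 : IsUnit (-48 : R) := by
    have h : IsUnit ((2 : R) ^ 4 * 3) := (h2.pow 4).mul h3
    norm_num at h
    exact h.neg
  have h864 : IsUnit (-864 : R) := by
    have h : IsUnit ((2 : R) ^ 5 * 3 ^ 3) := (h2.pow 5).mul (h3.pow 3)
    norm_num at h
    exact h.neg
  have ha₄ : uniformizer R ^ 4 ∣ (D • X.integralModel R).a₄ := by
    rw [← mem_maximalIdeal_pow_iff_dvd, ← Ideal.unit_mul_mem_iff_mem _ h48, ← c₄_of_isShortNF,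
      hSc₄]
    exact hc₄4
  have ha₆ : uniformizer R ^ 6 ∣ (D • X.integralModel R).a₆ := by
    rw [← mem_maximalIdeal_pow_iff_dvd, ← Ideal.unit_mul_mem_iff_mem _ h864, ← c₆_of_isShortNF,
      hSc₆, mem_maximalIdeal_pow_iff_dvd]
    exact hc₆
  have key := not_isMinimal_of_pow_dvd K hIΔ D
    (by rw [a₁_of_isShortNF]; exact dvd_zero _) (by rw [a₂_of_isShortNF]; exact dvd_zero _)
    (by rw [a₃_of_isShortNF]; exact dvd_zero _) ha₄ ha₆
  rw [baseChange_integralModel_eq R X] at key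
  exact key ‹_›

/-- **Minimality criterion** (Silverman, AEC VII.1, Remark 1.1), the `if` half, valid in every
residue characteristic: an `R`-integral equation which does not have both `Δ ∈ 𝔪¹²` and
`c₄ ∈ 𝔪⁴` is minimal. Indeed an integral `C • X` with `v (Δ (C • X)) > v (Δ (X))` has
`v (u) < 1`, i.e. `v (u) ≤ exp (-1)`, and then `Δ (X) = u¹² Δ (C • X) ∈ 𝔪¹²`,
`c₄ (X) = u⁴ c₄ (C • X) ∈ 𝔪⁴`. [cite: SilvermanAEC2009, VII.1 Remark 1.1 (PDF p. 165)] -/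
theorem isMinimal_of_not_Δ_mem_pow_and_c₄_mem_pow (X : WeierstrassCurve K) [hX : IsIntegral R X]
    (h : ¬ ((X.integralModel R).Δ ∈ IsLocalRing.maximalIdeal R ^ 12 ∧
        (X.integralModel R).c₄ ∈ IsLocalRing.maximalIdeal R ^ 4)) : IsMinimal R X := by
  rw [isMinimal_iff_of_le_one_iff (valuation_maximalIdeal_le_one_iff R (K := K))]
  refine ⟨hX, fun C hC ↦ ?_⟩
  haveI := hC
  by_contra hlt
  rw [not_le] at hlt
  apply h
  -- the scaling is a non-unit of `R`
  have hu : valuation K (maximalIdeal R) (C.u : K) < 1 := by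
    by_contra hu
    rw [not_lt] at hu
    refine absurd ?_ (not_le.mpr hlt)
    rw [variableChange_Δ, map_mul, map_pow, map_units_inv]
    calc (valuation K (maximalIdeal R) (C.u : K))⁻¹ ^ 12 * valuation K (maximalIdeal R) X.Δ
        ≤ 1 * valuation K (maximalIdeal R) X.Δ :=
          mul_le_mul_left (pow_le_one' (inv_le_one_of_one_le₀ hu) _) _
      _ = valuation K (maximalIdeal R) X.Δ := one_mul _
  obtain ⟨c, hc⟩ := exists_lift_of_le_one hu.le
  have hc1 : valuation K (maximalIdeal R) (C.u : K) ≤ WithZero.exp (-(1 : ℕ) : ℤ) := by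
    rw [← hc, valuation_maximalIdeal_algebraMap_le_exp_neg_iff, pow_one]
    rw [← hc, valuation_maximalIdeal_algebraMap_lt_one_iff] at hu
    exact hu
  have eΔ : X.Δ = (C.u : K) ^ 12 * (C • X).Δ := by
    rw [variableChange_Δ, ← mul_assoc, ← mul_pow, Units.mul_inv, one_pow, one_mul]
  have ec₄ : X.c₄ = (C.u : K) ^ 4 * (C • X).c₄ := by
    rw [variableChange_c₄, ← mul_assoc, ← mul_pow, Units.mul_inv, one_pow, one_mul]
  have iΔ : valuation K (maximalIdeal R) (C • X).Δ ≤ 1 := by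
    rw [← integralModel_Δ_eq R (C • X)]; exact valuation_le_one _ _
  have ic₄ : valuation K (maximalIdeal R) (C • X).c₄ ≤ 1 := by
    rw [← integralModel_c₄_eq R (C • X)]; exact valuation_le_one _ _
  constructor
  · rw [← valuation_maximalIdeal_algebraMap_le_exp_neg_iff R (K := K), integralModel_Δ_eq, eΔ,
      map_mul, map_pow]
    calc valuation K (maximalIdeal R) (C.u : K) ^ 12 * valuation K (maximalIdeal R) (C • X).Δ
        ≤ WithZero.exp (-(1 : ℕ) : ℤ) ^ 12 * 1 := mul_le_mul' (pow_le_pow_left' hc1 12) iΔ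
      _ = WithZero.exp (-(12 : ℕ) : ℤ) := by
          rw [mul_one, ← WithZero.exp_nsmul]; norm_num
  · rw [← valuation_maximalIdeal_algebraMap_le_exp_neg_iff R (K := K), integralModel_c₄_eq, ec₄,
      map_mul, map_pow]
    calc valuation K (maximalIdeal R) (C.u : K) ^ 4 * valuation K (maximalIdeal R) (C • X).c₄
        ≤ WithZero.exp (-(1 : ℕ) : ℤ) ^ 4 * 1 := mul_le_mul' (pow_le_pow_left' hc1 4) ic₄
      _ = WithZero.exp (-(4 : ℕ) : ℤ) := by
          rw [mul_one, ← WithZero.exp_nsmul]; norm_num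


/-! ### Local constancy of Rohrlich's local root number (residue characteristic `≠ 2, 3`) -/

omit [IsDomain R] [IsDiscreteValuationRing R] in
open Polynomial in
/-- The node-tangent polynomial of Mathlib's `HasSplitMultiplicativeReduction`, reduced modulo `𝔪`,
only depends on the reduction of the equation modulo `𝔪`. [folklore] -/
theorem map_nodalTangents_eq_of_map_eq {k : Type*} [CommRing k] (f : R →+* k)
    {I₁ I₂ : WeierstrassCurve R} (h : I₂.map f = I₁.map f) :
    Polynomial.map f (C I₂.c₄ * X ^ 2 + C (I₂.a₁ * I₂.c₄) * X
        - C (54 * I₂.b₆ - 3 * I₂.b₂ * I₂.b₄ + I₂.a₂ * I₂.c₄)) =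
      Polynomial.map f (C I₁.c₄ * X ^ 2 + C (I₁.a₁ * I₁.c₄) * X
        - C (54 * I₁.b₆ - 3 * I₁.b₂ * I₁.b₄ + I₁.a₂ * I₁.c₄)) := by
  have hc₄ : f I₂.c₄ = f I₁.c₄ := by rw [← map_c₄, ← map_c₄, h]
  have ha₁ : f I₂.a₁ = f I₁.a₁ := by rw [← map_a₁, ← map_a₁, h]
  have ha₂ : f I₂.a₂ = f I₁.a₂ := by rw [← map_a₂, ← map_a₂, h]
  have hb₂ : f I₂.b₂ = f I₁.b₂ := by rw [← map_b₂, ← map_b₂, h]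
  have hb₄ : f I₂.b₄ = f I₁.b₄ := by rw [← map_b₄, ← map_b₄, h]
  have hb₆ : f I₂.b₆ = f I₁.b₆ := by rw [← map_b₆, ← map_b₆, h]
  simp only [Polynomial.map_sub, Polynomial.map_add, Polynomial.map_mul, Polynomial.map_pow,
    Polynomial.map_C, Polynomial.map_X, map_mul, map_sub, map_add, map_ofNat, hc₄, ha₁, ha₂, hb₂,
    hb₄, hb₆]

/-- **Local constancy of the local root number in residue characteristic `≠ 2, 3`** (general
DVR form). Let `R` be a DVR in which `2` and `3` are units, `K = Frac R`, `v` the valuation of `K`,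
and `W₁` an `R`-integral Weierstrass equation with `Δ ≠ 0`. There is `z ∈ Kˣ` such that every
Weierstrass equation `W₂` over `K` with `v (aⱼ(W₂) − aⱼ(W₁)) < v (z)` (`j = 1, 2, 3, 4, 6`) has
the same local root number `WeierstrassCurve.localRootNumber R` (Rohrlich's case list on a minimal
model: reduction type, `ord Δ_min`, `ord c₄,min`, residue field) as `W₁`.

This is the residue-characteristic-`≥ 5` case of Helfgott 2004, Prop. 4.2 and of the last
paragraph of the proof of Prop. 4.3 (PDF p. 11: "there is one change of variables that sends any
nearby `𝐚₁, …, 𝐚₆ ∈ 𝒪_K` with `𝚫 ≠ 0` to a minimal Weierstrass model … Thus, the reduction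
type is constant in the neighbourhood … When an elliptic curve has multiplicative reduction, the
root number depends only on whether the reduction is split or unsplit; when an elliptic curve has
additive, potentially multiplicative reduction, the root number depends only on `K` and the class
of `−c₆` in `K*/(K*)²`"), where in residue characteristic `≥ 5` the root number of a curve with
potentially good reduction is Rohrlich's function of `e = 12 / gcd(v(Δ_min), 12)` and of the
residue field (Rohrlich 1993, Prop. 2), as transcribed by `WeierstrassCurve.localRootNumber`, so
that the Tate-module argument of Prop. 4.2 is not needed. Proof: let `X₁ = D • W₁` be the chosen
minimal model, `D = ⟨u, r, s, t⟩`; then `u, r, s, t ∈ R` (AEC VII.1.3(d),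
`valuation_u_le_one_of_isMinimal_smul`, `exists_lift_variableChange_of_isIntegral`), so for
`v (aⱼ(W₂) − aⱼ(W₁)) < v (u)⁶ exp (−N)` the equation `X₂ = D • W₂` is integral and congruent to `X₁`
modulo `𝔪ᴺ` (`valuation_variableChange_sub_lt`); for `N > ord Δ(X₁), ord c₄(X₁)` this forces
`ord Δ(X₂) = ord Δ(X₁)`, `ord c₄(X₂) = ord c₄(X₁)` (or both `c₄` deep in `𝔪ᴺ` when `c₄(X₁) = 0`),
minimality of `X₂` (criterion `¬(Δ ∈ 𝔪¹² ∧ c₄ ∈ 𝔪⁴)` in residue characteristic `≠ 2, 3`), equal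
reductions modulo `𝔪`, hence the same reduction type and the same splitting of the node; the chosen
minimal model of `W₂` carries the same data as `X₂` (AEC VII.1.3(b), the tree's
`…_iff_of_isMinimal_of_eq_smul` lemmas).
[cite: Helfgott2004RootNumberFamilies, §4 Prop. 4.2 and proof of Prop. 4.3 (last paragraph)]
[cite: Rohrlich1993Compositio, Prop. 2] [cite: SilvermanAEC2009, VII.1 Prop. 1.3 and Remark 1.1] -/
theorem localRootNumber_locallyConstant_of_isUnit (h2 : IsUnit (2 : R)) (h3 : IsUnit (3 : R))
    (W₁ : WeierstrassCurve K) [IsIntegral R W₁] (hΔ₁ : W₁.Δ ≠ 0) :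
    ∃ z : K, z ≠ 0 ∧ ∀ W₂ : WeierstrassCurve K,
      valuation K (maximalIdeal R) (W₂.a₁ - W₁.a₁) < valuation K (maximalIdeal R) z →
      valuation K (maximalIdeal R) (W₂.a₂ - W₁.a₂) < valuation K (maximalIdeal R) z →
      valuation K (maximalIdeal R) (W₂.a₃ - W₁.a₃) < valuation K (maximalIdeal R) z →
      valuation K (maximalIdeal R) (W₂.a₄ - W₁.a₄) < valuation K (maximalIdeal R) z →
      valuation K (maximalIdeal R) (W₂.a₆ - W₁.a₆) < valuation K (maximalIdeal R) z →
      W₂.localRootNumber R = W₁.localRootNumber R := by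
  -- the chosen minimal model `X₁ = D • W₁` of `W₁`
  obtain ⟨D, hD⟩ : ∃ D : VariableChange K, W₁.minimal R = D • W₁ := ⟨_, rfl⟩
  set X₁ := W₁.minimal R with hX₁
  haveI hX₁min : IsMinimal R X₁ := by rw [hX₁]; infer_instance
  haveI hDmin : IsMinimal R (D • W₁) := hD ▸ hX₁min
  have hX₁Δ : X₁.Δ ≠ 0 := by
    rw [hD, variableChange_Δ]; exact mul_ne_zero (pow_ne_zero _ (Units.ne_zero _)) hΔ₁
  -- `u, r, s, t ∈ R` (Silverman, AEC VII.1.3(d))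
  have hu : valuation K (maximalIdeal R) (D.u : K) ≤ 1 :=
    valuation_u_le_one_of_isMinimal_smul R W₁ D hΔ₁
  obtain ⟨⟨r, hr⟩, ⟨s, hs⟩, ⟨t, ht⟩⟩ := exists_lift_variableChange_of_isIntegral R W₁ D hu
  have hr' : valuation K (maximalIdeal R) D.r ≤ 1 := hr ▸ valuation_le_one _ r
  have hs' : valuation K (maximalIdeal R) D.s ≤ 1 := hs ▸ valuation_le_one _ s
  have ht' : valuation K (maximalIdeal R) D.t ≤ 1 := ht ▸ valuation_le_one _ t
  -- the modulus `N`: `exp (-N) < v (Δ (X₁))`, and `exp (-N) < v (c₄ (X₁))` unless `c₄ (X₁) = 0`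
  have hνΔ₁ : valuation K (maximalIdeal R) X₁.Δ ≠ 0 := (Valuation.ne_zero_iff _).2 hX₁Δ
  obtain ⟨N₁, hN₁⟩ := WithZero.exists_exp_neg_natCast_lt hνΔ₁
  obtain ⟨N₂, hN₂⟩ : ∃ N₂ : ℕ, X₁.c₄ ≠ 0 →
      WithZero.exp (-(N₂ : ℤ)) < valuation K (maximalIdeal R) X₁.c₄ := by
    by_cases hc : X₁.c₄ = 0
    · exact ⟨0, fun h ↦ absurd hc h⟩
    · obtain ⟨N₂, hN₂⟩ := WithZero.exists_exp_neg_natCast_lt ((Valuation.ne_zero_iff _).2 hc)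
      exact ⟨N₂, fun _ ↦ hN₂⟩
  set N := max N₁ N₂ with hN
  have hNΔ : WithZero.exp (-(N : ℤ)) < valuation K (maximalIdeal R) X₁.Δ :=
    lt_of_le_of_lt (WithZero.exp_le_exp.2 (by omega)) hN₁
  have hNc₄ : X₁.c₄ ≠ 0 → WithZero.exp (-(N : ℤ)) < valuation K (maximalIdeal R) X₁.c₄ :=
    fun h ↦ lt_of_le_of_lt (WithZero.exp_le_exp.2 (by omega)) (hN₂ h)
  have hN0 : WithZero.exp (-(N : ℤ)) < (1 : WithZero (Multiplicative ℤ)) :=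
    lt_of_lt_of_le hNΔ (by rw [← integralModel_Δ_eq R X₁]; exact valuation_le_one _ _)
  -- a uniformiser and the threshold `z = u⁶ πᴺ`
  obtain ⟨π, hπ⟩ := valuation_exists_uniformizer K (maximalIdeal R)
  have hπN : valuation K (maximalIdeal R) (π ^ N) = WithZero.exp (-(N : ℤ)) := by
    rw [map_pow, hπ, ← WithZero.exp_nsmul]; simp
  have hπ0 : π ≠ 0 := by
    intro h0; rw [h0, map_zero] at hπ; exact WithZero.exp_ne_zero hπ.symm
  refine ⟨(D.u : K) ^ 6 * π ^ N, mul_ne_zero (pow_ne_zero _ D.u.ne_zero) (pow_ne_zero _ hπ0),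
    fun W₂ h₁ h₂ h₃ h₄ h₆ ↦ ?_⟩
  rw [map_mul, map_pow, hπN] at h₁ h₂ h₃ h₄ h₆
  -- the same change of variables applied to `W₂`: `X₂ = D • W₂ ≡ X₁ (mod 𝔪ᴺ)`
  obtain ⟨k₁, k₂, k₃, k₄, k₆⟩ :=
    valuation_variableChange_sub_lt (valuation K (maximalIdeal R)) hu hr' hs' ht' h₁ h₂ h₃ h₄ h₆
  rw [← hD] at k₁ k₂ k₃ k₄ k₆
  set X₂ := D • W₂ with hX₂
  haveI hX₂int : IsIntegral R X₂ :=
    isIntegral_of_valuation_sub_le_one R (k₁.trans hN0).le (k₂.trans hN0).le (k₃.trans hN0).le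
      (k₄.trans hN0).le (k₆.trans hN0).le
  obtain ⟨hΔsub, hc₄sub⟩ := valuation_Δ_sub_le_and_c₄_sub_le R k₁.le k₂.le k₃.le k₄.le k₆.le
  have hνΔ : valuation K (maximalIdeal R) X₂.Δ = valuation K (maximalIdeal R) X₁.Δ :=
    Valuation.map_eq_of_sub_lt _ (hΔsub.trans_lt hNΔ)
  have hX₂Δ : X₂.Δ ≠ 0 := (Valuation.ne_zero_iff _).1 (hνΔ ▸ hνΔ₁)
  have hred := map_integralModel_eq_of_valuation_sub_lt_one R (k₁.trans hN0) (k₂.trans hN0)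
    (k₃.trans hN0) (k₄.trans hN0) (k₆.trans hN0)
  -- `X₂` is minimal (criterion in residue characteristic `≠ 2, 3`)
  have hcrit₁ := not_Δ_mem_pow_and_c₄_mem_pow_of_isMinimal R h2 h3 X₁ hX₁Δ
  haveI hX₂min : IsMinimal R X₂ := by
    refine isMinimal_of_not_Δ_mem_pow_and_c₄_mem_pow R X₂ ?_
    rintro ⟨hΔ12, hc₄4⟩
    apply hcrit₁
    constructor
    · rw [← valuation_maximalIdeal_algebraMap_le_exp_neg_iff R (K := K), integralModel_Δ_eq]
        at hΔ12 ⊢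
      rwa [← hνΔ]
    · rw [← valuation_maximalIdeal_algebraMap_le_exp_neg_iff R (K := K), integralModel_c₄_eq]
        at hc₄4 ⊢
      by_cases hc : X₁.c₄ = 0
      · rw [hc, map_zero]; exact zero_le
      · rwa [← Valuation.map_eq_of_sub_lt _ (hc₄sub.trans_lt (hNc₄ hc))]
  -- the chosen minimal model of `W₂` versus `X₂` (AEC VII.1.3(b))
  obtain ⟨D₂, hD₂⟩ : ∃ D' : VariableChange K, W₂.minimal R = D' • W₂ := ⟨_, rfl⟩
  have hrel : W₂.minimal R = (D₂ * D⁻¹) • X₂ := by rw [hD₂, hX₂, mul_smul, inv_smul_smul]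
  have tg := hasGoodReduction_iff_of_isMinimal_of_eq_smul R hrel
  have tm := hasMultiplicativeReduction_iff_of_isMinimal_of_eq_smul R hrel hX₂Δ
  have ts := hasSplitMultiplicativeReduction_iff_of_isMinimal_of_eq_smul R hrel hX₂Δ
  have tvΔ : addVal R ((W₂.minimal R).integralModel R).Δ = addVal R (X₂.integralModel R).Δ := by
    apply addVal_eq_addVal_of_valuation_algebraMap_eq R (L := K)
    rw [integralModel_Δ_eq, integralModel_Δ_eq]
    exact valuation_Δ_eq_of_isMinimal_of_eq_smul R hrel
  have tvc₄ : addVal R ((W₂.minimal R).integralModel R).c₄ =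
      addVal R (X₂.integralModel R).c₄ := by
    apply addVal_eq_addVal_of_valuation_algebraMap_eq R (L := K)
    rw [integralModel_c₄_eq, integralModel_c₄_eq]
    exact valuation_c₄_eq_of_isMinimal_of_eq_smul R hrel hX₂Δ
  -- `X₂` versus `X₁` (congruence modulo `𝔪ᴺ`)
  have sg : X₂.HasGoodReduction R ↔ X₁.HasGoodReduction R := by
    rw [hasGoodReduction_iff, hasGoodReduction_iff, hνΔ]
    exact and_congr_left' ⟨fun _ ↦ hX₁min, fun _ ↦ hX₂min⟩
  have svΔ : addVal R (X₂.integralModel R).Δ = addVal R (X₁.integralModel R).Δ := by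
    apply addVal_eq_addVal_of_valuation_algebraMap_eq R (L := K)
    rw [integralModel_Δ_eq, integralModel_Δ_eq]
    exact hνΔ
  have sP := map_nodalTangents_eq_of_map_eq R (algebraMap R (IsLocalRing.ResidueField R)) hred
  by_cases hc : X₁.c₄ = 0
  · -- `c₄ (X₁) = 0`: then `c₄ (X₂) ∈ 𝔪ᴺ` with `N > ord Δ (X₂) = ord Δ (X₁)`; neither curve is
    -- multiplicative, and the branch `3 ord c₄ < ord Δ` is not taken on either side
    rw [hc, sub_zero] at hc₄sub
    have hm₁ : ¬ X₁.HasMultiplicativeReduction R := fun h ↦ by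
      have h1 := h.multiplicativeReduction
      rw [hc, map_zero] at h1
      exact zero_ne_one h1
    have hm₂ : ¬ X₂.HasMultiplicativeReduction R := fun h ↦
      (lt_of_le_of_lt hc₄sub hN0).ne h.multiplicativeReduction
    have hs₁ : ¬ X₁.HasSplitMultiplicativeReduction R := fun h ↦ hm₁ h.toHasMultiplicativeReduction
    have hs₂ : ¬ X₂.HasSplitMultiplicativeReduction R := fun h ↦ hm₂ h.toHasMultiplicativeReduction
    have hI₁c₄ : (X₁.integralModel R).c₄ = 0 :=
      (injective_iff_map_eq_zero _).1 (IsFractionRing.injective R K) _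
        (by rw [integralModel_c₄_eq, hc])
    have h3₁ : ¬ 3 * addVal R (X₁.integralModel R).c₄ < addVal R (X₁.integralModel R).Δ := by
      rw [hI₁c₄, addVal_zero, ENat.mul_top (by norm_num)]
      exact not_top_lt
    have hdN : addVal R (X₁.integralModel R).Δ < N := by
      rw [← not_le, ← Literature.NumberTheory.DiophantineGeometry.TateAlgorithm.pow_dvd_iff_le_addVal,
        ← Literature.NumberTheory.DiophantineGeometry.TateAlgorithm.mem_maximalIdeal_pow_iff_dvd,
        ← valuation_maximalIdeal_algebraMap_le_exp_neg_iff R (K := K), integralModel_Δ_eq, not_le]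
      exact hNΔ
    have hNc : (N : ℕ∞) ≤ addVal R (X₂.integralModel R).c₄ := by
      rw [← Literature.NumberTheory.DiophantineGeometry.TateAlgorithm.pow_dvd_iff_le_addVal,
        ← Literature.NumberTheory.DiophantineGeometry.TateAlgorithm.mem_maximalIdeal_pow_iff_dvd,
        ← valuation_maximalIdeal_algebraMap_le_exp_neg_iff R (K := K), integralModel_c₄_eq]
      exact hc₄sub
    have h3₂ : ¬ 3 * addVal R (X₂.integralModel R).c₄ < addVal R (X₁.integralModel R).Δ := by
      rw [not_lt]
      calc addVal R (X₁.integralModel R).Δ ≤ N := hdN.le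
        _ ≤ addVal R (X₂.integralModel R).c₄ := hNc
        _ ≤ addVal R (X₂.integralModel R).c₄ + 2 * addVal R (X₂.integralModel R).c₄ :=
          le_self_add
        _ = 3 * addVal R (X₂.integralModel R).c₄ := by ring
    simp only [localRootNumber, ← hX₁, tg, tm, ts, tvΔ, tvc₄, sg, hm₁, hm₂, hs₁, hs₂, svΔ, h3₁,
      h3₂, if_false]
  · -- `c₄ (X₁) ≠ 0`: then `ord c₄ (X₂) = ord c₄ (X₁)` as well
    have hνc₄ : valuation K (maximalIdeal R) X₂.c₄ = valuation K (maximalIdeal R) X₁.c₄ :=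
      Valuation.map_eq_of_sub_lt _ (hc₄sub.trans_lt (hNc₄ hc))
    have sm : X₂.HasMultiplicativeReduction R ↔ X₁.HasMultiplicativeReduction R := by
      rw [hasMultiplicativeReduction_iff, hasMultiplicativeReduction_iff, hνΔ, hνc₄]
      exact and_congr_left' ⟨fun _ ↦ hX₁min, fun _ ↦ hX₂min⟩
    have ss : X₂.HasSplitMultiplicativeReduction R ↔ X₁.HasSplitMultiplicativeReduction R := by
      rw [hasSplitMultiplicativeReduction_iff, hasSplitMultiplicativeReduction_iff]
      exact ⟨fun ⟨h₁, h₂⟩ ↦ ⟨sm.mp h₁, by simpa only [sP] using h₂⟩,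
        fun ⟨h₁, h₂⟩ ↦ ⟨sm.mpr h₁, by simpa only [sP] using h₂⟩⟩
    have svc₄ : addVal R (X₂.integralModel R).c₄ = addVal R (X₁.integralModel R).c₄ := by
      apply addVal_eq_addVal_of_valuation_algebraMap_eq R (L := K)
      rw [integralModel_c₄_eq, integralModel_c₄_eq]
      exact hνc₄
    simp only [localRootNumber, ← hX₁, tg, tm, ts, tvΔ, tvc₄, sg, sm, ss, svΔ, svc₄]


end DVR

end WeierstrassCurve

/-! ### Over `ℚ_v`, `v ∤ 6`: clause (5) of `Helfgott2004_exists_local_tables_locallyConstant`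
for Rohrlich's table, and the reduction of the named fact to the places above `2` and `3` -/

namespace Literature.NumberTheory.EllipticCurves

open WeierstrassCurve IsDiscreteValuationRing

/-- Above a prime `p > 3`, `2` and `3` are units of `O_v = v.adicCompletionIntegers ℚ` (the residue
field of `O_v` is `𝔽_p`, `Rat.ringChar_residueField_adicCompletionIntegers`). [folklore] -/
theorem isUnit_two_and_three_adicCompletionIntegers {v : HeightOneSpectrum ℤ}
    (hv : 3 < ringChar (ℤ ⧸ v.asIdeal)) :
    IsUnit (2 : v.adicCompletionIntegers ℚ) ∧ IsUnit (3 : v.adicCompletionIntegers ℚ) := by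
  rw [← Rat.ringChar_residueField_adicCompletionIntegers v] at hv
  have hk : ∀ n : ℕ, 0 < n → n ≤ 3 →
      (n : IsLocalRing.ResidueField (v.adicCompletionIntegers ℚ)) ≠ 0 := fun n hn hn3 h0 ↦ by
    have hle := Nat.le_of_dvd hn ((ringChar.spec _ _).1 h0)
    omega
  refine ⟨(IsLocalRing.residue_ne_zero_iff_isUnit _).1 ?_,
    (IsLocalRing.residue_ne_zero_iff_isUnit _).1 ?_⟩
  · rw [map_ofNat]; exact_mod_cast hk 2 two_pos (by norm_num)
  · rw [map_ofNat]; exact_mod_cast hk 3 three_pos le_rfl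

/-- **Local constancy of the local root number over `ℚ_v`, `v ∤ 6`** (Helfgott 2004, Prop. 4.2
and proof of Prop. 4.3, `K = ℚ_v` of residue characteristic `p ≥ 5`, where `W(E/ℚ_v)` is
Rohrlich's `WeierstrassCurve.localRootNumber`): for an elliptic `W'` over `ℚ_v` with `v`-integral
coefficients there is `n` such that every `W''` with `v (𝐚ⱼ − aⱼ) < exp (−n)` (`j = 1, 2, 3, 4, 6`)
has the same local root number. This is clause (5) of
`Helfgott2004_exists_local_tables_locallyConstant` at the places `v ∤ 6` for the table
`w_v = localRootNumber (O_v)` (the valuation `Valued.v` of `ℚ_v` is equivalent to the `𝔪`-adic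
valuation of `O_v`, `isEquiv_valuation_maximalIdeal_of_le_one_iff`).
[cite: Helfgott2004RootNumberFamilies, §4 Prop. 4.2 and proof of Prop. 4.3]
[cite: Rohrlich1993Compositio, Prop. 2] -/
theorem localRootNumber_adicCompletion_locallyConstant {v : HeightOneSpectrum ℤ}
    (hv : 3 < ringChar (ℤ ⧸ v.asIdeal)) (W' : WeierstrassCurve (v.adicCompletion ℚ))
    (hW' : W'.IsElliptic) (h₁ : W'.a₁ ∈ v.adicCompletionIntegers ℚ)
    (h₂ : W'.a₂ ∈ v.adicCompletionIntegers ℚ) (h₃ : W'.a₃ ∈ v.adicCompletionIntegers ℚ)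
    (h₄ : W'.a₄ ∈ v.adicCompletionIntegers ℚ) (h₆ : W'.a₆ ∈ v.adicCompletionIntegers ℚ) :
    ∃ n : ℕ, ∀ W'' : WeierstrassCurve (v.adicCompletion ℚ),
      Valued.v (W''.a₁ - W'.a₁) < WithZero.exp (-(n : ℤ)) →
      Valued.v (W''.a₂ - W'.a₂) < WithZero.exp (-(n : ℤ)) →
      Valued.v (W''.a₃ - W'.a₃) < WithZero.exp (-(n : ℤ)) →
      Valued.v (W''.a₄ - W'.a₄) < WithZero.exp (-(n : ℤ)) →
      Valued.v (W''.a₆ - W'.a₆) < WithZero.exp (-(n : ℤ)) →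
        W''.localRootNumber (v.adicCompletionIntegers ℚ) =
          W'.localRootNumber (v.adicCompletionIntegers ℚ) := by
  obtain ⟨h2, h3⟩ := isUnit_two_and_three_adicCompletionIntegers hv
  haveI : IsIntegral (v.adicCompletionIntegers ℚ) W' :=
    isIntegral_of_exists_lift _ ⟨⟨_, h₁⟩, rfl⟩ ⟨⟨_, h₂⟩, rfl⟩ ⟨⟨_, h₃⟩, rfl⟩ ⟨⟨_, h₄⟩, rfl⟩
      ⟨⟨_, h₆⟩, rfl⟩
  haveI := hW'
  obtain ⟨z, hz0, hz⟩ := localRootNumber_locallyConstant_of_isUnit (v.adicCompletionIntegers ℚ)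
    h2 h3 W' W'.isUnit_Δ.ne_zero
  have hE := isEquiv_valuation_maximalIdeal_of_le_one_iff
    (valued_le_one_iff_mem_range_adicCompletionIntegers (K := ℚ) v)
  obtain ⟨n, hn⟩ := WithZero.exists_exp_neg_natCast_lt
    ((Valuation.ne_zero_iff (Valued.v (R := v.adicCompletion ℚ))).2 hz0)
  refine ⟨n, fun W'' k₁ k₂ k₃ k₄ k₆ ↦ hz W'' (hE.lt_iff_lt.2 (k₁.trans hn))
    (hE.lt_iff_lt.2 (k₂.trans hn)) (hE.lt_iff_lt.2 (k₃.trans hn)) (hE.lt_iff_lt.2 (k₄.trans hn))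
    (hE.lt_iff_lt.2 (k₆.trans hn))⟩

/-- **Clause (5) of `Helfgott2004_exists_local_tables_locallyConstant` holds at every place
`v ∤ 6` for any table agreeing with Rohrlich's `localRootNumber` on elliptic curves** (clause (3)):
local constancy there is a property of `localRootNumber (O_v)`
(`localRootNumber_adicCompletion_locallyConstant`).
[cite: Helfgott2004RootNumberFamilies, §4 Prop. 4.2 and proof of Prop. 4.3] -/
theorem locallyConstant_of_eq_localRootNumber {v : HeightOneSpectrum ℤ}
    (hv : 3 < ringChar (ℤ ⧸ v.asIdeal)) {w : WeierstrassCurve (v.adicCompletion ℚ) → ℤ}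
    (hw : ∀ W' : WeierstrassCurve (v.adicCompletion ℚ), W'.IsElliptic →
      w W' = W'.localRootNumber (v.adicCompletionIntegers ℚ))
    (W' : WeierstrassCurve (v.adicCompletion ℚ)) (hW' : W'.IsElliptic)
    (h₁ : W'.a₁ ∈ v.adicCompletionIntegers ℚ) (h₂ : W'.a₂ ∈ v.adicCompletionIntegers ℚ)
    (h₃ : W'.a₃ ∈ v.adicCompletionIntegers ℚ) (h₄ : W'.a₄ ∈ v.adicCompletionIntegers ℚ)
    (h₆ : W'.a₆ ∈ v.adicCompletionIntegers ℚ) :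
    ∃ n : ℕ, ∀ W'' : WeierstrassCurve (v.adicCompletion ℚ), W''.IsElliptic →
      W''.a₁ ∈ v.adicCompletionIntegers ℚ → W''.a₂ ∈ v.adicCompletionIntegers ℚ →
      W''.a₃ ∈ v.adicCompletionIntegers ℚ → W''.a₄ ∈ v.adicCompletionIntegers ℚ →
      W''.a₆ ∈ v.adicCompletionIntegers ℚ →
      Valued.v (W''.a₁ - W'.a₁) < WithZero.exp (-(n : ℤ)) →
      Valued.v (W''.a₂ - W'.a₂) < WithZero.exp (-(n : ℤ)) →
      Valued.v (W''.a₃ - W'.a₃) < WithZero.exp (-(n : ℤ)) →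
      Valued.v (W''.a₄ - W'.a₄) < WithZero.exp (-(n : ℤ)) →
      Valued.v (W''.a₆ - W'.a₆) < WithZero.exp (-(n : ℤ)) → w W'' = w W' := by
  obtain ⟨n, hn⟩ := localRootNumber_adicCompletion_locallyConstant hv W' hW' h₁ h₂ h₃ h₄ h₆
  refine ⟨n, fun W'' hW'' _ _ _ _ _ k₁ k₂ k₃ k₄ k₆ ↦ ?_⟩
  rw [hw W'' hW'', hw W' hW']
  exact hn W'' k₁ k₂ k₃ k₄ k₆

/-- **The tables of `exists_local_tables_two_three` are locally constant away from `2, 3`.**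
From local tables `w_v` with clauses (1)–(4) one gets clause (5) of
`Helfgott2004_exists_local_tables_locallyConstant` at every place of residue characteristic `> 3`
for free (`locallyConstant_of_eq_localRootNumber`). [cite: Helfgott2004RootNumberFamilies, §4 Prop. 4.2 and proof of Prop. 4.3] -/
theorem exists_local_tables_locallyConstant_of_two_three (h : exists_local_tables_two_three) :
    ∃ w : (v : HeightOneSpectrum ℤ) → WeierstrassCurve (v.adicCompletion ℚ) → ℤ,
      (∀ v W', w v W' = 1 ∨ w v W' = -1) ∧
      (∀ v W' (C : VariableChange (v.adicCompletion ℚ)), w v (C • W') = w v W') ∧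
      (∀ v (W' : WeierstrassCurve (v.adicCompletion ℚ)), W'.IsElliptic →
        3 < ringChar (ℤ ⧸ v.asIdeal) → w v W' = W'.localRootNumber (v.adicCompletionIntegers ℚ)) ∧
      (∀ W : WeierstrassCurve ℚ, W.IsElliptic →
        W.rootNumber = -∏ᶠ v : HeightOneSpectrum ℤ, w v (W.baseChange (v.adicCompletion ℚ))) ∧
      ∀ (v : HeightOneSpectrum ℤ), 3 < ringChar (ℤ ⧸ v.asIdeal) →
        ∀ (W' : WeierstrassCurve (v.adicCompletion ℚ)), W'.IsElliptic →
        W'.a₁ ∈ v.adicCompletionIntegers ℚ → W'.a₂ ∈ v.adicCompletionIntegers ℚ →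
        W'.a₃ ∈ v.adicCompletionIntegers ℚ → W'.a₄ ∈ v.adicCompletionIntegers ℚ →
        W'.a₆ ∈ v.adicCompletionIntegers ℚ →
        ∃ n : ℕ,
          ∀ W'' : WeierstrassCurve (v.adicCompletion ℚ), W''.IsElliptic →
            W''.a₁ ∈ v.adicCompletionIntegers ℚ → W''.a₂ ∈ v.adicCompletionIntegers ℚ →
            W''.a₃ ∈ v.adicCompletionIntegers ℚ → W''.a₄ ∈ v.adicCompletionIntegers ℚ →
            W''.a₆ ∈ v.adicCompletionIntegers ℚ →
            Valued.v (W''.a₁ - W'.a₁) < WithZero.exp (-(n : ℤ)) →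
            Valued.v (W''.a₂ - W'.a₂) < WithZero.exp (-(n : ℤ)) →
            Valued.v (W''.a₃ - W'.a₃) < WithZero.exp (-(n : ℤ)) →
            Valued.v (W''.a₄ - W'.a₄) < WithZero.exp (-(n : ℤ)) →
            Valued.v (W''.a₆ - W'.a₆) < WithZero.exp (-(n : ℤ)) → w v W'' = w v W' := by
  obtain ⟨w, h1, h2, h3, h4⟩ := h
  exact ⟨w, h1, h2, h3, h4, fun v hv W' hW' ha₁ ha₂ ha₃ ha₄ ha₆ ↦
    locallyConstant_of_eq_localRootNumber hv (fun W'' hW'' ↦ h3 v W'' hW'' hv) W' hW'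
      ha₁ ha₂ ha₃ ha₄ ha₆⟩

/-- **Reduction of Helfgott's local constancy to the places above `2` and `3`.** The named fact
`Helfgott2004_exists_local_tables_locallyConstant` is equivalent to the existence of local tables
`w_v` with clauses (1)–(4) of `exists_local_tables_two_three` whose local constancy (clause (5))
is required **only at the places of residue characteristic `≤ 3`**: at every other place clause
(3) identifies `w_v` with Rohrlich's `localRootNumber (O_v)` on elliptic curves, which is locally
constant by `localRootNumber_adicCompletion_locallyConstant` (Helfgott 2004, Prop. 4.2 and proof of
Prop. 4.3 in residue characteristic `≥ 5`). What remains of the named fact beyond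
`exists_local_tables_two_three` is thus exactly Helfgott's §4 at `v ∣ 6` for the true local root
numbers `W(E/ℚ₂)`, `W(E/ℚ₃)` (Deligne–Langlands `ε`-factors; Halberstadt's tables).
[cite: Helfgott2004RootNumberFamilies, §4 Prop. 4.2, Prop. 4.3 (proof) and Lemma 4.4] -/
theorem Helfgott2004_exists_local_tables_locallyConstant_iff_two_three :
    Helfgott2004_exists_local_tables_locallyConstant ↔
    ∃ w : (v : HeightOneSpectrum ℤ) → WeierstrassCurve (v.adicCompletion ℚ) → ℤ,
      (∀ v W', w v W' = 1 ∨ w v W' = -1) ∧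
      (∀ v W' (C : VariableChange (v.adicCompletion ℚ)), w v (C • W') = w v W') ∧
      (∀ v (W' : WeierstrassCurve (v.adicCompletion ℚ)), W'.IsElliptic →
        3 < ringChar (ℤ ⧸ v.asIdeal) → w v W' = W'.localRootNumber (v.adicCompletionIntegers ℚ)) ∧
      (∀ W : WeierstrassCurve ℚ, W.IsElliptic →
        W.rootNumber = -∏ᶠ v : HeightOneSpectrum ℤ, w v (W.baseChange (v.adicCompletion ℚ))) ∧
      ∀ (v : HeightOneSpectrum ℤ), ringChar (ℤ ⧸ v.asIdeal) ≤ 3 →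
        ∀ (W' : WeierstrassCurve (v.adicCompletion ℚ)), W'.IsElliptic →
        W'.a₁ ∈ v.adicCompletionIntegers ℚ → W'.a₂ ∈ v.adicCompletionIntegers ℚ →
        W'.a₃ ∈ v.adicCompletionIntegers ℚ → W'.a₄ ∈ v.adicCompletionIntegers ℚ →
        W'.a₆ ∈ v.adicCompletionIntegers ℚ →
        ∃ n : ℕ,
          ∀ W'' : WeierstrassCurve (v.adicCompletion ℚ), W''.IsElliptic →
            W''.a₁ ∈ v.adicCompletionIntegers ℚ → W''.a₂ ∈ v.adicCompletionIntegers ℚ →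
            W''.a₃ ∈ v.adicCompletionIntegers ℚ → W''.a₄ ∈ v.adicCompletionIntegers ℚ →
            W''.a₆ ∈ v.adicCompletionIntegers ℚ →
            Valued.v (W''.a₁ - W'.a₁) < WithZero.exp (-(n : ℤ)) →
            Valued.v (W''.a₂ - W'.a₂) < WithZero.exp (-(n : ℤ)) →
            Valued.v (W''.a₃ - W'.a₃) < WithZero.exp (-(n : ℤ)) →
            Valued.v (W''.a₄ - W'.a₄) < WithZero.exp (-(n : ℤ)) →
            Valued.v (W''.a₆ - W'.a₆) < WithZero.exp (-(n : ℤ)) → w v W'' = w v W' := by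
  constructor
  · rintro ⟨w, h1, h2, h3, h4, h5⟩
    exact ⟨w, h1, h2, h3, h4, fun v _ ↦ h5 v⟩
  · rintro ⟨w, h1, h2, h3, h4, h5⟩
    refine ⟨w, h1, h2, h3, h4, fun v W' hW' ha₁ ha₂ ha₃ ha₄ ha₆ ↦ ?_⟩
    by_cases hv : 3 < ringChar (ℤ ⧸ v.asIdeal)
    · exact locallyConstant_of_eq_localRootNumber hv (fun W'' hW'' ↦ h3 v W'' hW'' hv) W' hW'
        ha₁ ha₂ ha₃ ha₄ ha₆
    · exact h5 v (not_lt.1 hv) W' hW' ha₁ ha₂ ha₃ ha₄ ha₆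

end Literature.NumberTheory.EllipticCurves

end
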